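import Mathlib
import HarnessLib
import Summits.NavierStokesRegularity.NavierStokesRegularity.Theorems.PoloidalWindowDoorLrcModEntireQ4CurvedTranslationFlat

/-!
# Route `PoloidalWindowDoor`, item `LrcModEntire` (stmt-NavierStokesRegularity-20428), cell (Q4-curved), VERTICAL child —
# THE v19 LITERAL SUBSUMES THE v18 LITERAL: flattening arcs (Y_T) give an asymptotic translation period (Y_P″); so does a straight base curve

Cell ns-regularity-ideate, stub-worker seat ns-poloidal-K2-p2 g19 under the LEAD of item 20428 (ns-poloidal-K2-p3 g18); `--supports stmt-NavierStokesRegularity-20428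
--as helper`.  Bookkeeping for the statement of record of the residue `…UniformlyCurvedNoAsymptoticPeriod` (registry v19, b49b09d089527323): of its negative curve
clauses, ¬Y_T («no flattening arcs», v18) and «Γ is not a line» are CONSEQUENCES of ¬Y_P″ («no asymptotic translation period along any sequence of arcs», v19), so the
residue's curve-side content is ¬Y_P″ alone (plus aperiodic curvature, which is NOT implied: periodic curvature with a rotational monodromy gives a bounded rosette,
excluded separately by properness of hot branches).

* ★ `asymptoticPeriod_of_flat` — `C²` planar unit-speed `Γ` with Y_T ⊢ Y_P″ (with `L = 1`, `τ = e`): by T1 `…Q4CurvedTranslationFlat.exists_flat_direction` a subsequence of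
  the base points has `Γ(a n + s) − Γ(a n) → s•e`, hence `Γ(a n + s + 1) − Γ(a n + s) → e`.
* `asymptoticPeriod_of_line` — a straight base curve `Γ s = s • v` (`v ≠ 0` not even needed) has the exact, hence asymptotic, period `(L, τ) = (1, v)`.

WHAT THIS IS NOT: not a claim about Navier–Stokes regularity; literal bookkeeping; closes nothing; items 20428 / 19708 / 27893 OPEN (bears_on LADDER-NS N0).
-/

noncomputable section

set_option linter.dupNamespace false
set_option linter.style.longLine false

namespace Summit.NavierStokesRegularity.NavierStokesRegularity.Theorems.PoloidalWindowDoorLrcModEntireQ4CurvedAsymptoticPeriodOfFlat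

open Set Function Filter Topology Metric
open Summit.NavierStokesRegularity.NavierStokesRegularity.Theorems.PoloidalWindowDoorLrcModEntireQ4CurvedTranslationFlat

/-- ★ **Y_T ⇒ Y_P″**: flattening arcs of a `C²` planar unit-speed curve give an asymptotic translation period (`L = 1`). -/
theorem asymptoticPeriod_of_flat {Γ : ℝ → EuclideanSpace ℝ (Fin 3)} (hΓ : ContDiff ℝ 2 Γ) (hΓ2 : ∀ s, Γ s 2 = 0) (hunit : ∀ s, ‖deriv Γ s‖ = 1)
    (hflat : ∃ a : ℕ → ℝ, ∀ A ε : ℝ, 0 < ε → ∀ᶠ n in atTop, ∀ s : ℝ, |s| ≤ A → ‖deriv (deriv Γ) (a n + s)‖ ≤ ε) :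
    ∃ (a : ℕ → ℝ) (L : ℝ) (τ : EuclideanSpace ℝ (Fin 3)), L ≠ 0 ∧ ∀ s : ℝ, Tendsto (fun n : ℕ => Γ (a n + s + L) - Γ (a n + s)) atTop (𝓝 τ) := by
  obtain ⟨a, ha⟩ := hflat
  obtain ⟨φ, -, e, -, -, hlim⟩ := exists_flat_direction hΓ hΓ2 hunit ha
  refine ⟨fun j => a (φ j), 1, e, one_ne_zero, fun s => ?_⟩
  have h := (hlim (s + 1)).sub (hlim s)
  have heq : (fun j => (Γ (a (φ j) + (s + 1)) - Γ (a (φ j))) - (Γ (a (φ j) + s) - Γ (a (φ j)))) =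
      fun j => Γ (a (φ j) + s + 1) - Γ (a (φ j) + s) := by
    funext j; rw [← add_assoc]; abel
  rw [heq] at h
  have hτ : (s + 1) • e - s • e = e := by rw [add_smul, one_smul]; abel
  rw [hτ] at h
  exact h

/-- **A straight base curve has an asymptotic (indeed exact) translation period.** -/
theorem asymptoticPeriod_of_line {Γ : ℝ → EuclideanSpace ℝ (Fin 3)} {v : EuclideanSpace ℝ (Fin 3)} (hline : ∀ s : ℝ, Γ s = s • v) :
    ∃ (a : ℕ → ℝ) (L : ℝ) (τ : EuclideanSpace ℝ (Fin 3)), L ≠ 0 ∧ ∀ s : ℝ, Tendsto (fun n : ℕ => Γ (a n + s + L) - Γ (a n + s)) atTop (𝓝 τ) := by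
  refine ⟨fun _ => 0, 1, v, one_ne_zero, fun s => ?_⟩
  have h : (fun _ : ℕ => Γ (0 + s + 1) - Γ (0 + s)) = fun _ => v := by
    funext n
    rw [hline, hline, add_smul, one_smul]
    abel
  rw [h]
  exact tendsto_const_nhds

end Summit.NavierStokesRegularity.NavierStokesRegularity.Theorems.PoloidalWindowDoorLrcModEntireQ4CurvedAsymptoticPeriodOfFlat

end
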